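/-
Copyright (c) 2026 the pub-hodgecm-mathlib formalisation cell (harness21).  Prover seat hodgecm-mathlib-K2E4-p16 (g2), Track B «K2-LIT» ∕ h413 = stmt-HodgeConjecture-24833,
unit U5Kazhdan of the line `K2_E3_EllipticInputs`: the WILD twin of E1 row 72-NW `F0P3cStCharTSK2PrimeL2Tame` (K2E3-plan (g1) DEALS BATCH #2 22:15:20Z; wild-engine line lead
K2E3-p17 FILE ↦ SEAT MAP 22:22:15Z «K2E4-p16 (g2) = `Theorems/K2E3K2PrimeL2Wild.lean`»).  2026-09-03.
-/
import Summits.HodgeConjecture.HodgeConjecture.Theorems.K2E3EPNormOneWild            -- ★ W₁ file (K2E3-p15): §A-W `innerG_char_self_eq_one_of_ramificationIdx_ne_one_explicit` (★ 73-W (C)-W trunk + ★ 58-W-W `hpc3` + ★ 61b-W `h61` inside) and §R-W `innerG_char_self_eq_one_of_hsplit_of_ramificationIdx_ne_one_explicit` (the ★73 §R twin: «HSPLIT ⇒ EP-NORM-ONE» at a ramified place, explicit letters)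
import Summits.HodgeConjecture.HodgeConjecture.Theorems.F0P3cStCharTSK2PrimeL2Tame                    -- ★ 72-NW p853724 (LH6-p03 g10): the TAME template — its PLACE-FREE inputs BY NAME (★ 56-B1 `exists_apartmentEnum_of_involution`, ★ 43, ★ H-RAM `_of_involution` topology, ★ (S5) `hsplit_of_isSquareIntegrable`, ★ row 72 §B UNR, ★ row 58 FILE 1 §0, ★ `isUnramifiedIn_of_ramificationIdx'_eq_one`, ★ `galAdicCompletionMap_galAdicCompletionMap_of_smul_eq`)
import HarnessLib

/-!
# K2_E3 road (h413 = stmt-HodgeConjecture-24833), unit U5Kazhdan — THE WILD ENGINE, FILE «72-W» `K2E3K2PrimeL2Wild`: (K2′) `⟨χ_σ, χ_σ⟩_e = 1` FOR EVERY `L²` CLASS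
# OF `U(Φ₃)(L⁺_v)` AT EVERY RAMIFIED PLACE (tame re-proved, WILD = dyadic ramified new) — and hence at EVERY non-split place with NO place token

Cell `pub/hodgecm-mathlib` (D-0151), Track B «K2-LIT» engine E3, socket item `stmt-HodgeConjecture-24833` (h413; lane `--supports … --as helper`); seat
`hodgecm-mathlib-K2E4-p16` (g2); dealer K2E3-plan (g1) DEALS BATCH #2 (22:15:20Z); wild engine line lead K2E3-p17 (FILE ↦ SEAT MAP 22:22:15Z).  THEOREMS ONLY (no definition ∕
instance ∕ notation ∕ named fact ∕ `sorry`); ★-only imports (never a `Cruxes/…/Lines` module).  Namespace `Summit.HodgeConjecture.HodgeConjecture.Cruxes.H413.K2E3K2PrimeL2Wild`.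

WHAT.  The WILD twin of ★ 72-NW `F0P3cStCharTSK2PrimeL2Tame` (p853724): the same statements with the tame block `(hσ hvσ hϖ hσϖ hres h2 hnorm)` (`σ_w ϖ = −ϖ`, `|2|_w = 1`, …)
replaced IN ITS SLOT by `(hew : e(w∣v) ≠ 1) (hϖ : |ϖ|_w = exp (−1))` — ANY uniformiser at ANY ramified place, the dyadic (wild) ones included — every other binder and every
conclusion VERBATIM (TEMPLATE RULE of the wild chain, K2E3-p17 ∕ K2E3-p21: names `…_of_ramificationIdx_ne_one`, `_of_involution`∕`_of_v` heads BY NAME, tame dischargers re-issued):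
* (§A-W — the twin of ★ 72-NW §A-RAM, i.e. the ★ 73-W (C)-trunk with ★ 58-W-W `hpc3` and ★ 61b-W `h61` inside — lives in the ★ W₁ file `K2E3EPNormOneWild` (K2E3-p15), next to the
  ★73 §R twin «HSPLIT ⇒ EP-NORM-ONE»; it is NOT restated here: K2 bus 22:28:54Z ∕ 22:33:00Z, one statement — one file.)
* §B-W `innerG_char_self_eq_one_of_isL2_of_ramificationIdx_ne_one_explicit` — twin of ★ 72-NW §B-RAM: text 2 of (S-𝔑) `hBlock′` for every `L²` class at a RAMIFIED place, explicit letters,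
  ZERO binders beyond the letters; proof = ONE LINE over ★ `K2E3EPNormOneWild.innerG_char_self_eq_one_of_hsplit_of_ramificationIdx_ne_one_explicit` (the ★73 §R twin: level ∕ tree ∕
  base-edge ∕ `K`-type choices made once, `hsplit` the only family binder) with `hsplit := ★ (S5) F0P3cStCharTSHsplitOfL2.hsplit_of_isSquareIntegrable … μZ r (hμGZ ▸ ‹𝔇.IsL2 ⟦r⟧›)`
  (place-free: ★ `u3SquareIntegrableExponents_holds` is stated at EVERY non-split `v`) — where ★ 72-NW §B-RAM re-ran ★ 69 (T2b)'s 80-line construction, the wild twin reuses ★73's;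
* §T1-W `innerG_char_self_eq_one_of_isL2_of_explicit` — the junction from the two explicit twins with NO PLACE TOKEN: pick `w ∣ v` and the one-place model `eA` (★ `localNonsplitEquiv`
  re-read on `Φ₃`); if `e(w∣v) = 1` the place is unramified (★ `isUnramifiedIn_of_ramificationIdx'_eq_one`, ★ `unramifiedLocalConjDatum_adicCompletion`) and ★ row 72 §B UNR applies;
  else ANY uniformiser of `L_w` (Mathlib `valuation_exists_uniformizer` + `valuedAdicCompletion_eq_valuation'`) and §B-W — ★ 72-NW §T1's three-way case split collapses to two;
* §T3-W `innerG_char_self_eq_one_of_isL2` — junction letters, NO place token: §T1-W over ★ row 72 §B `F0P3cStCharTSK2PrimeL2Unr.innerG_char_self_eq_one_of_isL2_of_unramified_explicit` and §B-W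
  (supersedes ★ 72-NW §T3 `…_of_isL2_of_not_wild`, whose `hv` token is now idle);
* §L-W `innerG_char_self_eq_one_of_isL2_organLetter` — the organ's remaining (K2′) letter `hL2oneNsNWR` (leaf `F0_P3c_StCharTSPaydown.lean` :476–477; = conjunct 2 of tier-0 stub 5
  `K2E3EllipticInputs.stub_kazhdanOrthogonalityWild`) TOKEN FOR TOKEN after the colon, its wild guard `¬ (v unramified ∨ |2|_v = 1)` and the `St`-exclusion going IDLE: one line over §T3-W.
So the rung-0 citation [Rogawski1990 Prop. 12.6.1 (a)] «if π is square-integrable then `⟨χ_π, χ_π⟩_e = 1`», which ★ 72-NW left standing «ONLY at wild non-split `v`», is now a THEOREM at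
every non-split place of a CM extension (EP road: Schneider–Stuhler pseudo-coefficients on the ramified `(q+1, q+1)` tree; no Plancherel ∕ Howe–Clozel input).

HONEST LABEL: `--supports stmt-HodgeConjecture-24833` helper (the K2′-`L²` brick of tier-0 stub 5's wild residue; U5Kazhdan consumes it via W₁∕#15 or directly); retires nothing by
itself; HC_CM is proved only modulo the 7 printed citations (2 remaining named inputs: hLiu418 = stmt-HodgeConjecture-24832, h413 = stmt-HodgeConjecture-24833) until rung 0 closes.

## References
* [Rogawski1990] J. D. Rogawski, *Automorphic Representations of Unitary Groups in Three Variables*, Ann. of Math. Stud. 123 (1990), §12.5 pp. 182–187, §12.6 Prop. 12.6.1 (a) p. 188.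
* [SchneiderStuhler1997] P. Schneider, U. Stuhler, *Representation theory and sheaves on the Bruhat–Tits building*, Publ. Math. IHÉS 85 (1997), §III.4 (Thm. III.4.16).
* [Kottwitz1988] R. Kottwitz, *Tamagawa numbers*, Ann. of Math. 127 (1988), §2.
* [BruhatTits1972] F. Bruhat, J. Tits, *Groupes réductifs sur un corps local I*, Publ. Math. IHÉS 41 (1972), §10.
* [Tits1979] J. Tits, *Reductive groups over local fields*, PSPM 33.1 (1979), §2.7 (the ramified quasi-split `²A₂`: a `(q+1, q+1)` tree).
* [Serre1979] J.-P. Serre, *Local Fields*, GTM 67 (1979), Ch. IV §1–§2 (ramified quadratic extensions, wild case).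
-/

set_option autoImplicit false
-- the mandated namespace has the single-problem summit's repeated segment (`HodgeConjecture.HodgeConjecture`)
set_option linter.dupNamespace false

noncomputable section

open NumberField IsDedekindDomain MeasureTheory Filter Topology
open scoped Matrix MatrixGroups Pointwise Valued WithZero ComplexConjugate
open Literature.NumberTheory.Rogawski1990 Literature.NumberTheory.Rogawski1990.Ch12Sec5
open Literature.NumberTheory.Automorphic Literature.NumberTheory.Automorphic.UnitaryGroup Literature.NumberTheory.Automorphic.UnitaryLatticeTree
open Literature.NumberTheory.Automorphic.HermitianLattice
open Literature.NumberTheory.GaloisRepresentations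
open Literature.Combinatorics.SimpleGraph Literature.Combinatorics.SimpleGraph.OrientedIncidence
open Literature.NumberTheory.Automorphic.Liu2021.LemD1IndexedNonVacuityTameSynthesis (isUnramifiedIn_of_ramificationIdx'_eq_one)

namespace Summit.HodgeConjecture.HodgeConjecture.Cruxes.H413.K2E3K2PrimeL2Wild

open Summit.HodgeConjecture.HodgeConjecture.Cruxes.H413
open Summit.HodgeConjecture.HodgeConjecture.Cruxes.H413.F0P3cStCharTSTorusDefs
open Summit.HodgeConjecture.HodgeConjecture.Cruxes.H413.K2E3EPNormOneWild

variable (L : Type) [Field L] [NumberField L] [IsCMField L] (v : HeightOneSpectrum (𝓞 ↥(maximalRealSubfield L)))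

/-! ## §B-W ROW 72-W «K2′-L²-RAMIFIED», (G3)-EXPLICIT: text 2 of (S-𝔑) `hBlock′` at a RAMIFIED place (tame or wild), antecedents VERBATIM, ZERO binders beyond the letters -/

/-- **ROW 72-W «K2′-L²-RAMIFIED ASSEMBLY HEAD», (G3)-EXPLICIT letters.**  At a non-split RAMIFIED place `v` (`hew : e(w∣v) ≠ 1`, tame OR wild) with the one-place model
`(w hw ϖ ‹hew hϖ› eA heA)` (`ϖ` ANY uniformiser of `L_w`), at a §12.5 datum `𝔇` with the junction pins `hμG hμGZ horb hreg hE hM1` and ★ PCT-OUT's `hWIF hC1 hC2 hC3 hL2`: **for every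
`σ ∈ Irr U(Φ₃)(L⁺_v)` square-integrable modulo the centre (`𝔇.IsL2 σ`), `⟨χ_σ, χ_σ⟩_e = 1`** — text 2 (`hL2oneNsNW`) of the (S-𝔑) organ with its antecedents VERBATIM (`¬ σ.IsSupercuspidal`
and the NOT-WILD∧St exclusion go IDLE), with NO binder beyond the letters.  Twin of ★ 72-NW §B-RAM `F0P3cStCharTSK2PrimeL2Tame.innerG_char_self_eq_one_of_isL2_of_neg_explicit` (the seven tame
letters ↦ `hew hϖ` IN SLOT).  Proof = ONE LINE: ★ `K2E3EPNormOneWild.innerG_char_self_eq_one_of_hsplit_of_ramificationIdx_ne_one_explicit` (K2E3-p15; the ★73 §R twin, which makes ★ 69 (T2b)'s level ∕ tree ∕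
base-edge ∕ `K`-type choices ONCE over the place-free ★ `_of_involution` bricks and closes by its §A-W = ★ 73-W ∘ ★ 58-W-W ∘ ★ 61b-W) at `r` with `hsplit := ★ (S5)
F0P3cStCharTSHsplitOfL2.hsplit_of_isSquareIntegrable … μZ r (hμGZ ▸ ‹𝔇.IsL2 ⟦r⟧›)` (place-free).  NO unitarity ∕ `IsEllipticRep` letter.  [cite: Rogawski1990, §12.6 Prop. 12.6.1 (a) p. 188] [cite: SchneiderStuhler1997, Thm. III.4.16, §III.4] [cite: Kottwitz1988, §2] [cite: BruhatTits1972, §10] [cite: Tits1979, §2.7] -/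
theorem innerG_char_self_eq_one_of_isL2_of_ramificationIdx_ne_one_explicit
    (hns : ∀ w : PlacesOver L v, IsCMField.complexConj L • w.1 = w.1)
    (w : PlacesOver L v) (hw : IsCMField.complexConj L • w.1 = w.1) {ϖ : w.1.adicCompletion L}
    (hew : v.asIdeal.ramificationIdx' w.1.asIdeal ≠ 1) (hϖ : Valued.v ϖ = WithZero.exp (-1 : ℤ))
    (eA : Gqs L v ≃ₜ* ↥(unitaryGroupOfForm (galAdicCompletionMap (L := L) (IsCMField.complexConj L) hw) ((StdForm.antidiagonal 3).over (w.1.adicCompletion L))))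
    (heA : ∀ g : Gqs L v, ((eA g : ↥(unitaryGroupOfForm (galAdicCompletionMap (L := L) (IsCMField.complexConj L) hw) ((StdForm.antidiagonal 3).over (w.1.adicCompletion L)))) : GL (Fin 3) (w.1.adicCompletion L)) = ((localNonsplitEquiv (IsCMField.complexConj L) (qsForm L) (IsCMField.complexConj_ne_one L) w hw g : ↥(unitaryGroupOfForm (galAdicCompletionMap (L := L) (IsCMField.complexConj L) hw) (placeForm (qsForm L) w.1))) : GL (Fin 3) (w.1.adicCompletion L)))
    [MeasurableSpace (Gqs L v)] [BorelSpace (Gqs L v)]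
    [∀ γ : Gqs L v, MeasurableSpace (Gqs L v ⧸ Subgroup.centralizer ({γ} : Set (Gqs L v)))] [∀ γ : Gqs L v, BorelSpace (Gqs L v ⧸ Subgroup.centralizer ({γ} : Set (Gqs L v)))]
    [MeasurableSpace (Gqs L v ⧸ Subgroup.center (Gqs L v))] [BorelSpace (Gqs L v ⧸ Subgroup.center (Gqs L v))]
    {H : Type} [Group H] [TopologicalSpace H] [IsTopologicalGroup H] [MeasurableSpace H]
    (νQv : Measure (Gqs L v)) [νQv.IsHaarMeasure] [νQv.IsMulRightInvariant] (mQv : OrbitalMeasureFamily (Gqs L v))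
    (hcanQ : mQv.IsCanonical (fun γ => IsRegularElt (γ.val : GL (Fin 3) (UnitaryGroup.LocalRing L v))) νQv)
    (𝔇 : EllipticData (Gqs L v) H) (hμG : 𝔇.μG = νQv) (horb : 𝔇.orb = mQv)
    (hreg : ∀ γ : Gqs L v, γ ∈ 𝔇.regG ↔ IsRegularElt (γ.val : GL (Fin 3) (UnitaryGroup.LocalRing L v)))
    (hE : ∀ γ : Gqs L v, γ ∈ 𝔇.ellG ↔ IsRegularElt (γ.val : GL (Fin 3) (UnitaryGroup.LocalRing L v)) ∧ γ ∉ hyperbolicSet L v)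
    (hM1 : ∀ π : IrrClass (Gqs L v), Measurable (𝔇.char π) ∧ LocallyIntegrable (𝔇.char π) 𝔇.μG ∧ (∀ x ∈ 𝔇.regG, ∀ᶠ y in 𝓝 x, 𝔇.char π y = 𝔇.char π x) ∧
      ∀ φ : Gqs L v → ℂ, IsLocSmooth φ → π.smoothTrace 𝔇.μG φ = ∫ x, φ x * 𝔇.char π x ∂𝔇.μG)
    (μZ : Measure (Gqs L v ⧸ Subgroup.center (Gqs L v))) [μZ.IsHaarMeasure] (hμGZ : 𝔇.μGZ = μZ)   -- junction `hC03`
    (hWIF : 𝔇.WeylIntegrationFormula) (hC1 : 𝔇.EllCartanSubset) (hC2 : 𝔇.EllCartanAE) (hC3 : 𝔇.NonEllCartanAE) (hL2 : 𝔇.L2CharOnTorusAll) :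
    ∀ σ : IrrClass (Gqs L v), 𝔇.IsL2 σ → ¬ σ.IsSupercuspidal → ¬ ((Algebra.IsUnramifiedIn (𝓞 L) v.asIdeal ∨ Valued.v (2 : v.adicCompletion ↥(maximalRealSubfield L)) = 1) ∧ ∃ ψ : ↥(Subgroup.center (Gqs L v)) →* ℂˣ, Continuous ψ ∧ σ = 𝔇.stG ψ) → 𝔇.innerG (𝔇.char σ) (𝔇.char σ) = 1 := by
  intro σ
  induction σ using IrrClass.ind with
  | h r =>
  intro hL2σ _ _
  exact innerG_char_self_eq_one_of_hsplit_of_ramificationIdx_ne_one_explicit L v hns w hw hew hϖ eA heA νQv mQv hcanQ 𝔇 hμG horb hreg hE hM1 hWIF hC1 hC2 hC3 hL2 r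
    (F0P3cStCharTSHsplitOfL2.hsplit_of_isSquareIntegrable L v hns μZ r (hμGZ ▸ (hL2σ : IrrClass.IsSquareIntegrable 𝔇.μGZ (IrrClass.mk r))))


/-! ## §T1-W ROW 72-W AT EVERY NON-SPLIT PLACE, from the two explicit twins (★ 72-NW §T1's case split with the NOT-WILD token REMOVED) -/

/-- **§T1-W «K2′-L² FROM ITS TWO EXPLICIT TWINS, NO PLACE TOKEN».**  If text 2 holds at `𝔇` for every choice of the UNRAMIFIED letters `(w hw ϖ hd eA heA)` (`hK2X`, = ★ row 72 §B
`F0P3cStCharTSK2PrimeL2Unr.innerG_char_self_eq_one_of_isL2_of_unramified_explicit` partially applied) AND for every choice of the RAMIFIED letters `(w hw ϖ ‹hew hϖ› eA heA)` (`hK2Xwild`,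
= §B-W partially applied), then text 2 holds at `𝔇` — at EVERY non-split `v`, with no `hv` token: pick `w ∣ v` and the one-place model `eA` (★ `localNonsplitEquiv` re-read on `Φ₃`, as ★
72-NW §T1 ∕ ★ row 72 §C); if `e(w∣v) = 1` the place is unramified (★ `isUnramifiedIn_of_ramificationIdx'_eq_one`, ★ `unramifiedLocalConjDatum_adicCompletion`); else take ANY uniformiser
of `L_w` (Mathlib `IsDedekindDomain.HeightOneSpectrum.valuation_exists_uniformizer` read in the completion by `valuedAdicCompletion_eq_valuation'`).  ★ 72-NW §T1's third branch
(`|2|_w = 1` ⇒ the tame block ★ `ramifiedBlock_adicCompletion`) is no longer needed: §B-W takes every ramified place.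
[cite: Rogawski1990, §12.6 Prop. 12.6.1 (a) p. 188] [cite: SchneiderStuhler1997, §III.4] [cite: Kottwitz1988, §2] -/
theorem innerG_char_self_eq_one_of_isL2_of_explicit
    (hns : ∀ w : PlacesOver L v, IsCMField.complexConj L • w.1 = w.1)
    [MeasurableSpace (Gqs L v)]
    [∀ γ : Gqs L v, MeasurableSpace (Gqs L v ⧸ Subgroup.centralizer ({γ} : Set (Gqs L v)))]
    [MeasurableSpace (Gqs L v ⧸ Subgroup.center (Gqs L v))]
    {H : Type} [Group H] [TopologicalSpace H] [IsTopologicalGroup H] [MeasurableSpace H]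
    (𝔇 : EllipticData (Gqs L v) H)
    (hK2X : ∀ (w : PlacesOver L v) (hw : IsCMField.complexConj L • w.1 = w.1) (ϖ : w.1.adicCompletion L)
      (_hd : UnramifiedLocalConjDatum (galAdicCompletionMap (L := L) (IsCMField.complexConj L) hw) ϖ)
      (eA : Gqs L v ≃ₜ* ↥(unitaryGroupOfForm (galAdicCompletionMap (L := L) (IsCMField.complexConj L) hw) ((StdForm.antidiagonal 3).over (w.1.adicCompletion L))))
      (_heA : ∀ g : Gqs L v,
        ((eA g : ↥(unitaryGroupOfForm (galAdicCompletionMap (L := L) (IsCMField.complexConj L) hw) ((StdForm.antidiagonal 3).over (w.1.adicCompletion L)))) :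
            GL (Fin 3) (w.1.adicCompletion L)) =
          ((localNonsplitEquiv (IsCMField.complexConj L) (qsForm L) (IsCMField.complexConj_ne_one L) w hw g :
            ↥(unitaryGroupOfForm (galAdicCompletionMap (L := L) (IsCMField.complexConj L) hw) (placeForm (qsForm L) w.1))) : GL (Fin 3) (w.1.adicCompletion L))),
      ∀ σ : IrrClass (Gqs L v), 𝔇.IsL2 σ → ¬ σ.IsSupercuspidal → ¬ ((Algebra.IsUnramifiedIn (𝓞 L) v.asIdeal ∨ Valued.v (2 : v.adicCompletion ↥(maximalRealSubfield L)) = 1) ∧ ∃ ψ : ↥(Subgroup.center (Gqs L v)) →* ℂˣ, Continuous ψ ∧ σ = 𝔇.stG ψ) → 𝔇.innerG (𝔇.char σ) (𝔇.char σ) = 1)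
    (hK2Xwild : ∀ (w : PlacesOver L v) (hw : IsCMField.complexConj L • w.1 = w.1) (ϖ : w.1.adicCompletion L)
      (_hew : v.asIdeal.ramificationIdx' w.1.asIdeal ≠ 1) (_hϖ : Valued.v ϖ = WithZero.exp (-1 : ℤ))
      (eA : Gqs L v ≃ₜ* ↥(unitaryGroupOfForm (galAdicCompletionMap (L := L) (IsCMField.complexConj L) hw) ((StdForm.antidiagonal 3).over (w.1.adicCompletion L))))
      (_heA : ∀ g : Gqs L v,
        ((eA g : ↥(unitaryGroupOfForm (galAdicCompletionMap (L := L) (IsCMField.complexConj L) hw) ((StdForm.antidiagonal 3).over (w.1.adicCompletion L)))) :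
            GL (Fin 3) (w.1.adicCompletion L)) =
          ((localNonsplitEquiv (IsCMField.complexConj L) (qsForm L) (IsCMField.complexConj_ne_one L) w hw g :
            ↥(unitaryGroupOfForm (galAdicCompletionMap (L := L) (IsCMField.complexConj L) hw) (placeForm (qsForm L) w.1))) : GL (Fin 3) (w.1.adicCompletion L))),
      ∀ σ : IrrClass (Gqs L v), 𝔇.IsL2 σ → ¬ σ.IsSupercuspidal → ¬ ((Algebra.IsUnramifiedIn (𝓞 L) v.asIdeal ∨ Valued.v (2 : v.adicCompletion ↥(maximalRealSubfield L)) = 1) ∧ ∃ ψ : ↥(Subgroup.center (Gqs L v)) →* ℂˣ, Continuous ψ ∧ σ = 𝔇.stG ψ) → 𝔇.innerG (𝔇.char σ) (𝔇.char σ) = 1) :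
    ∀ σ : IrrClass (Gqs L v), 𝔇.IsL2 σ → ¬ σ.IsSupercuspidal → ¬ ((Algebra.IsUnramifiedIn (𝓞 L) v.asIdeal ∨ Valued.v (2 : v.adicCompletion ↥(maximalRealSubfield L)) = 1) ∧ ∃ ψ : ↥(Subgroup.center (Gqs L v)) →* ℂˣ, Continuous ψ ∧ σ = 𝔇.stG ψ) → 𝔇.innerG (𝔇.char σ) (𝔇.char σ) = 1 := by
  obtain ⟨w⟩ : Nonempty (PlacesOver L v) := inferInstance
  have hw : IsCMField.complexConj L • w.1 = w.1 := hns w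
  have hc1 : IsCMField.complexConj L ≠ 1 := IsCMField.complexConj_ne_one L
  -- the one-place model re-read on the literal form `Φ₃ = antidiag(1,1,1)` (★ (G3) :189–:196, as ★ 72-NW §T1)
  have hJw : placeForm (qsForm L) w.1 = (StdForm.antidiagonal 3).over (w.1.adicCompletion L) := by
    rw [placeForm, qsForm, antidiagOne_eq_over, StdForm.over_map]
  obtain ⟨eA, heA⟩ : ∃ eA : Gqs L v ≃ₜ* ↥(unitaryGroupOfForm (galAdicCompletionMap (L := L) (IsCMField.complexConj L) hw) ((StdForm.antidiagonal 3).over (w.1.adicCompletion L))),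
      ∀ g : Gqs L v, ((eA g : ↥(unitaryGroupOfForm (galAdicCompletionMap (L := L) (IsCMField.complexConj L) hw) ((StdForm.antidiagonal 3).over (w.1.adicCompletion L)))) :
          GL (Fin 3) (w.1.adicCompletion L)) =
        ((localNonsplitEquiv (IsCMField.complexConj L) (qsForm L) hc1 w hw g :
          ↥(unitaryGroupOfForm (galAdicCompletionMap (L := L) (IsCMField.complexConj L) hw) (placeForm (qsForm L) w.1))) : GL (Fin 3) (w.1.adicCompletion L)) := by
    rw [← hJw]
    exact ⟨localNonsplitEquiv (IsCMField.complexConj L) (qsForm L) hc1 w hw, fun g => rfl⟩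
  -- the place dichotomy: `e(w∣v) = 1` (unramified: the datum) or `e(w∣v) ≠ 1` (ramified, tame or wild: any uniformiser)
  by_cases he : v.asIdeal.ramificationIdx' w.1.asIdeal = 1
  · haveI : Algebra.IsQuadraticExtension ↥(maximalRealSubfield L) L := IsCMField.isQuadraticExtension L
    have hunr : Algebra.IsUnramifiedIn (𝓞 L) v.asIdeal := isUnramifiedIn_of_ramificationIdx'_eq_one L (IsCMField.complexConj L) v hc1 w hw he
    obtain ⟨ϖ, hd⟩ := unramifiedLocalConjDatum_adicCompletion (IsCMField.complexConj L) hc1 v w hw hunr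
    exact hK2X w hw ϖ hd eA heA
  · obtain ⟨π, hπ⟩ := IsDedekindDomain.HeightOneSpectrum.valuation_exists_uniformizer L w.1
    have hϖ : Valued.v (π : w.1.adicCompletion L) = WithZero.exp (-1 : ℤ) := by
      rw [IsDedekindDomain.HeightOneSpectrum.valuedAdicCompletion_eq_valuation', hπ]
    exact hK2Xwild w hw (π : w.1.adicCompletion L) he hϖ eA heA

/-! ## §T3-W ROW 72-W IN THE JUNCTION'S LETTERS AT EVERY NON-SPLIT PLACE — §T1-W over ★ row 72 §B (p853710) and §B-W: ZERO binders beyond the junction's letters, NO place token -/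

/-- **ROW 72-W «K2′-L² AT EVERY NON-SPLIT PLACE», junction letters** (the SAME argument list as ★ 72-NW §T3 `F0P3cStCharTSK2PrimeL2Tame.innerG_char_self_eq_one_of_isL2_of_not_wild` with the
place token `hv` DELETED; rider letter `hL2oneNW := fun _hv => innerG_char_self_eq_one_of_isL2 L v hns νQv mQv hcanQ 𝔇 hC01 hC04 hC05 hE hchar μZ hC03 hWIF hC1 hC2 hC3 hL2allcert`): at a
non-split place `v` of the CM extension `L ∕ L⁺` — unramified, tamely ramified or WILDLY ramified — text 2 of (S-𝔑) `hBlock′` holds at the §12.5 datum for every `L²` class: §T1-W fed by ★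
row 72 §B `F0P3cStCharTSK2PrimeL2Unr.innerG_char_self_eq_one_of_isL2_of_unramified_explicit` (unramified branch) and §B-W `innerG_char_self_eq_one_of_isL2_of_ramificationIdx_ne_one_explicit`
(ramified branch), each partially applied at the junction letters.  With this head the rung-0 citation [Rogawski1990 Prop. 12.6.1 (a)] for K2′ on `L²` classes — which ★ 72-NW §T3 left standing
«ONLY at wild non-split `v`» — is discharged at every non-split place.
[cite: Rogawski1990, §12.6 Prop. 12.6.1 (a) p. 188] [cite: SchneiderStuhler1997, §III.4] [cite: Kottwitz1988, §2] -/
theorem innerG_char_self_eq_one_of_isL2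
    (hns : ∀ w : PlacesOver L v, IsCMField.complexConj L • w.1 = w.1)
    [MeasurableSpace (Gqs L v)] [BorelSpace (Gqs L v)]
    [∀ γ : Gqs L v, MeasurableSpace (Gqs L v ⧸ Subgroup.centralizer ({γ} : Set (Gqs L v)))] [∀ γ : Gqs L v, BorelSpace (Gqs L v ⧸ Subgroup.centralizer ({γ} : Set (Gqs L v)))]
    [MeasurableSpace (Gqs L v ⧸ Subgroup.center (Gqs L v))]
    {H : Type} [Group H] [TopologicalSpace H] [IsTopologicalGroup H] [MeasurableSpace H]
    (νQv : Measure (Gqs L v)) [νQv.IsHaarMeasure] [νQv.IsMulRightInvariant] (mQv : OrbitalMeasureFamily (Gqs L v))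
    (hcanQ : mQv.IsCanonical (fun γ => IsRegularElt (γ.val : GL (Fin 3) (UnitaryGroup.LocalRing L v))) νQv)
    (𝔇 : EllipticData (Gqs L v) H) (hμG : 𝔇.μG = νQv) (horb : 𝔇.orb = mQv)
    (hreg : ∀ γ : Gqs L v, γ ∈ 𝔇.regG ↔ IsRegularElt (γ.val : GL (Fin 3) (UnitaryGroup.LocalRing L v)))
    (hE : ∀ γ : Gqs L v, γ ∈ 𝔇.ellG ↔ IsRegularElt (γ.val : GL (Fin 3) (UnitaryGroup.LocalRing L v)) ∧ γ ∉ hyperbolicSet L v)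
    (hM1 : ∀ π : IrrClass (Gqs L v), Measurable (𝔇.char π) ∧ LocallyIntegrable (𝔇.char π) 𝔇.μG ∧ (∀ x ∈ 𝔇.regG, ∀ᶠ y in 𝓝 x, 𝔇.char π y = 𝔇.char π x) ∧
      ∀ φ : Gqs L v → ℂ, IsLocSmooth φ → π.smoothTrace 𝔇.μG φ = ∫ x, φ x * 𝔇.char π x ∂𝔇.μG)
    [BorelSpace (Gqs L v ⧸ Subgroup.center (Gqs L v))] (μZ : Measure (Gqs L v ⧸ Subgroup.center (Gqs L v))) [μZ.IsHaarMeasure] (hμGZ : 𝔇.μGZ = μZ)   -- the head's `μZ` (leaf :215–216) + junction `hC03`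
    (hWIF : 𝔇.WeylIntegrationFormula) (hC1 : 𝔇.EllCartanSubset) (hC2 : 𝔇.EllCartanAE) (hC3 : 𝔇.NonEllCartanAE) (hL2 : 𝔇.L2CharOnTorusAll)   -- ★ PCT-OUT's extra letters
    :
    ∀ σ : IrrClass (Gqs L v), 𝔇.IsL2 σ → ¬ σ.IsSupercuspidal → ¬ ((Algebra.IsUnramifiedIn (𝓞 L) v.asIdeal ∨ Valued.v (2 : v.adicCompletion ↥(maximalRealSubfield L)) = 1) ∧ ∃ ψ : ↥(Subgroup.center (Gqs L v)) →* ℂˣ, Continuous ψ ∧ σ = 𝔇.stG ψ) → 𝔇.innerG (𝔇.char σ) (𝔇.char σ) = 1 :=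
  innerG_char_self_eq_one_of_isL2_of_explicit L v hns 𝔇
    (fun w hw _ hd eA heA =>
      F0P3cStCharTSK2PrimeL2Unr.innerG_char_self_eq_one_of_isL2_of_unramified_explicit L v hns w hw hd eA heA νQv mQv hcanQ 𝔇 hμG horb hreg hE hM1 μZ hμGZ
        hWIF hC1 hC2 hC3 hL2)
    (fun w hw _ hew hϖ eA heA =>
      innerG_char_self_eq_one_of_isL2_of_ramificationIdx_ne_one_explicit L v hns w hw hew hϖ eA heA νQv mQv hcanQ 𝔇 hμG horb hreg hE hM1 μZ hμGZ hWIF hC1 hC2 hC3 hL2)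

/-! ## §L-W THE ORGAN'S REMAINING (K2′) LETTER `hL2oneNsNWR` (leaf `F0_P3c_StCharTSPaydown.lean` :476–477 = conjunct 2 of tier-0 stub 5 `stub_kazhdanOrthogonalityWild`), TOKEN FOR TOKEN -/

/-- **(K2′) AT THE WILD PLACES, IN THE ORGAN'S OWN WORDS.**  The organ leaf's letter `hL2oneNsNWR` — «for every `L²` non-supercuspidal `σ` at a WILD place (`¬ (v unramified ∨ |2|_v = 1)`)
other than the datum's `St_G(ψ)`, `⟨χ_σ, χ_σ⟩_e = 1`» (= the second conjunct of the conclusion of tier-0 stub 5 `K2E3EllipticInputs.stub_kazhdanOrthogonalityWild`, bytes :265) — with its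
text after the colon VERBATIM, over the junction letters of §T3-W: the three guards (`¬ IsSupercuspidal`, the wild token, the `St`-exclusion) go IDLE, since §T3-W proves (K2′) for EVERY `L²`
class at EVERY non-split place.  One line over §T3-W.  [cite: Rogawski1990, §12.6 Prop. 12.6.1 (a) p. 188; §12.6 p. 188 «The existence of pseudo-coefficients follows from [K], Theorem 4.1»]
[cite: SchneiderStuhler1997, §III.4] -/
theorem innerG_char_self_eq_one_of_isL2_organLetter
    (hns : ∀ w : PlacesOver L v, IsCMField.complexConj L • w.1 = w.1)
    [MeasurableSpace (Gqs L v)] [BorelSpace (Gqs L v)]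
    [∀ γ : Gqs L v, MeasurableSpace (Gqs L v ⧸ Subgroup.centralizer ({γ} : Set (Gqs L v)))] [∀ γ : Gqs L v, BorelSpace (Gqs L v ⧸ Subgroup.centralizer ({γ} : Set (Gqs L v)))]
    [MeasurableSpace (Gqs L v ⧸ Subgroup.center (Gqs L v))]
    {H : Type} [Group H] [TopologicalSpace H] [IsTopologicalGroup H] [MeasurableSpace H]
    (νQv : Measure (Gqs L v)) [νQv.IsHaarMeasure] [νQv.IsMulRightInvariant] (mQv : OrbitalMeasureFamily (Gqs L v))
    (hcanQ : mQv.IsCanonical (fun γ => IsRegularElt (γ.val : GL (Fin 3) (UnitaryGroup.LocalRing L v))) νQv)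
    (𝔇 : EllipticData (Gqs L v) H) (hμG : 𝔇.μG = νQv) (horb : 𝔇.orb = mQv)
    (hreg : ∀ γ : Gqs L v, γ ∈ 𝔇.regG ↔ IsRegularElt (γ.val : GL (Fin 3) (UnitaryGroup.LocalRing L v)))
    (hE : ∀ γ : Gqs L v, γ ∈ 𝔇.ellG ↔ IsRegularElt (γ.val : GL (Fin 3) (UnitaryGroup.LocalRing L v)) ∧ γ ∉ hyperbolicSet L v)
    (hM1 : ∀ π : IrrClass (Gqs L v), Measurable (𝔇.char π) ∧ LocallyIntegrable (𝔇.char π) 𝔇.μG ∧ (∀ x ∈ 𝔇.regG, ∀ᶠ y in 𝓝 x, 𝔇.char π y = 𝔇.char π x) ∧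
      ∀ φ : Gqs L v → ℂ, IsLocSmooth φ → π.smoothTrace 𝔇.μG φ = ∫ x, φ x * 𝔇.char π x ∂𝔇.μG)
    [BorelSpace (Gqs L v ⧸ Subgroup.center (Gqs L v))] (μZ : Measure (Gqs L v ⧸ Subgroup.center (Gqs L v))) [μZ.IsHaarMeasure] (hμGZ : 𝔇.μGZ = μZ)   -- the head's `μZ` (leaf :215–216) + junction `hC03`
    (hWIF : 𝔇.WeylIntegrationFormula) (hC1 : 𝔇.EllCartanSubset) (hC2 : 𝔇.EllCartanAE) (hC3 : 𝔇.NonEllCartanAE) (hL2 : 𝔇.L2CharOnTorusAll)   -- ★ PCT-OUT's extra letters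
    :
    ∀ σ : IrrClass (Gqs L v), 𝔇.IsL2 σ → ¬ σ.IsSupercuspidal → ¬ (Algebra.IsUnramifiedIn (𝓞 L) v.asIdeal ∨ Valued.v (2 : v.adicCompletion ↥(maximalRealSubfield L)) = 1) → ¬ ((Algebra.IsUnramifiedIn (𝓞 L) v.asIdeal ∨ Valued.v (2 : v.adicCompletion ↥(maximalRealSubfield L)) = 1) ∧ ∃ ψ : ↥(Subgroup.center (Gqs L v)) →* ℂˣ, Continuous ψ ∧ σ = 𝔇.stG ψ) → 𝔇.innerG (𝔇.char σ) (𝔇.char σ) = 1 :=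
  fun σ hσ hsc _ hst => innerG_char_self_eq_one_of_isL2 L v hns νQv mQv hcanQ 𝔇 hμG horb hreg hE hM1 μZ hμGZ hWIF hC1 hC2 hC3 hL2 σ hσ hsc hst


end Summit.HodgeConjecture.HodgeConjecture.Cruxes.H413.K2E3K2PrimeL2Wild

end
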